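import Mathlib.LinearAlgebra.PiTensorProduct.Basis
import Mathlib.LinearAlgebra.PiTensorProduct.Finite
import Mathlib.LinearAlgebra.Basis.Prod
import Mathlib.LinearAlgebra.Basis.VectorSpace
import Mathlib.LinearAlgebra.Projection
import Mathlib.LinearAlgebra.FiniteDimensional.Basic
import Literature.NumberTheory.Automorphic.RestrictedTensorProductProofs
import Literature.NumberTheory.Automorphic.RestrictedTensorProductSmoothProofs
import HarnessLib

/-!
# Restricted tensor products of admissible representations are admissible (proof)

Topic `NumberTheory/Automorphic`; proof file for `RestrictedTensorProduct`, discharging its named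
fact `Literature.NumberTheory.Automorphic.IsRestrictedTensorProductRep.isAdmissible`
(`IsRestrictedTensorProductRep.isAdmissible_holds`): over a field `k`, a restricted tensor product
`(W, π, j)` of admissible representations `ρ i` of topological groups `G i`, taken with respect to
compact open subgroups `K i` and eventually `K i`-fixed base vectors `x₀ i`, almost all `ρ i`
being `K i`-spherical with `x₀ i ≠ 0`, is an admissible representation of `Πʳ i, [G i, K i]`
(Mathlib `RestrictedProduct` with its Mathlib topology). (Flath 1979, §2, Example 2; Bump 1997,
§3.3, pp. 293–294, Proposition 3.4.9, p. 312, and Theorem 3.4.4, p. 314.)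

Smoothness of `π`, the first half of admissibility, is the sibling fact
`IsRestrictedTensorProductRep.isSmooth`, discharged in `RestrictedTensorProductSmoothProofs`
(`isSmooth_holds`); the passage to one finite level `⨂_{i ∈ S} V i` uses
`IsRestrictedTensorProduct.exists_mem_range_liftFinset` of `RestrictedTensorProductProofs`. Both
sibling files are imported.

## The proof (`IsRestrictedTensorProductRep.isAdmissible_of`)

Let `K'` be a compact open subgroup of `Πʳ i, [G i, K i]`; we show that `W^{K'}` is
finite-dimensional.

1. (`exists_finset_mulSingle_mem_of_mem_nhds_one`) `K'` is a neighbourhood of `1`, and `𝓝 1` is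
   the image of `𝓝 1` in `∏ K_i` (`RestrictedProduct.nhds_eq_map_structureMap`, `nhds_pi`); so
   there is a finite `I` with `mulSingle i (K i) ⊆ K'` for `i ∉ I`, and
   `L i := K i ⊓ (mulSingle i)⁻¹ K'` is an open subgroup of `G i`, compact as a closed subset of
   `K i`, with `K i ≤ L i` for `i ∉ I`. By admissibility `P i := V_i^{L_i}` is
   finite-dimensional, and for `i` outside the finite set
   `Sb := S₀ ∪ I ∪ {i ∣ ρ i not spherical or x₀ i = 0} ∪ {i ∣ x₀ i ∉ V_i^{K_i}}` one has
   `P i ≤ V_i^{K_i} = k · x₀ i`.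
2. (`RestrictedTensorProductAux.mem_span_of_forall_fixed`, the algebraic heart: over a field,
   `(⨂ V_i)^{∏ L_i}` lies in the image of `⨂ V_i^{L_i}`.) A `K'`-fixed `w` lies in the image of
   `⨂_{i ∈ S} V_i` for a finite `S ⊇ Sb` (`IsRestrictedTensorProduct.exists_mem_range_liftFinset`
   of `RestrictedTensorProductProofs`) and is fixed by the
   `π (mulSingle i g)`, `g ∈ L i`, which act on `j (extend S m)` through the slot `i` alone
   (`IsRestrictedTensorProductRep.apply_mulSingle_restrictMultilinear`). Choose in each slot a
   basis of `V i` adapted to `P i` (`exists_basis_adapted`: a basis of `P i` plus a basis of a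
   complement). The pure tensors of basis vectors are linearly independent in `W`
   (`Basis.piTensorProduct` and injectivity of `liftFinset S`); grouping the expansion of `w`
   along the lines parallel to a slot `i` (`Finsupp.curry`), each line-sum is a vector of `V i`
   fixed by `L i` (`RestrictedTensorProductAux.slot`), hence has no coordinates off `P i`. So
   `w ∈ span {j (extend S m) ∣ m i ∈ P i ∀ i}`.
3. For `i ∈ S ∖ Sb`, `m i ∈ P i = k · x₀ i`; pulling out the scalars (`map_smul_univ`) shows these
   spanning vectors lie in `F :=` image of `⨂_{i ∈ Sb} P i → ⨂_{i ∈ Sb} V i → W`, which is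
   finite-dimensional (`PiTensorProduct.finite`). Hence `W^{K'} ≤ F` is finite-dimensional.

No averaging projector (Haar measure, invertibility of indices in `k`) is used, so the statement
is proved over an arbitrary field, exactly as vendored. On the locators: Bump states the
admissibility of tensor products as Proposition 3.4.9 (two factors, groups) and Theorem 3.4.4
(restricted tensor products of admissible modules over the restricted tensor product of Hecke
algebras); the vendored docstring's "Theorem 3.4.3" is Bump's neighbouring uniqueness theorem.

## References

* D. Flath, *Decomposition of representations into tensor products*, Proc. Sympos. Pure Math.
  33 (Corvallis 1979), part 1, 179–183, §2 (Example 2). doi:10.1090/pspum/033.1/546596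
  [Flath1979]
* D. Bump, *Automorphic forms and representations* (1997), §3.3 (pp. 293–294: restricted tensor
  products of representations), Proposition 3.4.9 (p. 312) and Theorem 3.4.4 (p. 314:
  admissibility of restricted tensor products of admissible modules). [Bump1997]
-/

open scoped RestrictedProduct TensorProduct
open Filter PiTensorProduct Topology

namespace Literature.NumberTheory.Automorphic

/-! ### The algebraic heart: invariants of a finite tensor product, slot by slot

Pure linear algebra over a field `k`, for a multilinear map `M` on finitely many slots whose
induced map on `⨂ i, V i` is injective (in the application, `M = hj.restrictMultilinear S` and
injectivity is part of `IsRestrictedTensorProduct`). -/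

namespace RestrictedTensorProductAux

universe uσ uk uV uW uU

variable {k : Type uk} [Field k]

/-- Over a field every subspace `P ≤ U` admits an *adapted basis*: a basis `b` of `U` and a set
`B'` of indices such that `b β ∈ P` for `β ∈ B'` and the coordinates of any `u ∈ P` vanish off
`B'` (take a basis of `P` and a basis of a complement). [folklore] -/
theorem exists_basis_adapted {U : Type uU} [AddCommGroup U] [Module k U] (P : Submodule k U) :
    ∃ (B : Type uU) (b : Module.Basis B k U) (B' : Set B),
      (∀ β ∈ B', b β ∈ P) ∧ ∀ u ∈ P, ∀ β, β ∉ B' → b.repr u β = 0 := by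
  obtain ⟨Q, hPQ⟩ := P.exists_isCompl
  let bP := Module.Basis.ofVectorSpace k P
  let bQ := Module.Basis.ofVectorSpace k Q
  let e := Submodule.prodEquivOfIsCompl P Q hPQ
  refine ⟨_, (bP.prod bQ).map e, Set.range Sum.inl, ?_, ?_⟩
  · rintro _ ⟨i, rfl⟩
    simp [e]
  · intro u hu β hβ
    obtain ⟨i, rfl⟩ : ∃ i, β = Sum.inr i := by
      cases β with
      | inl a => exact absurd ⟨a, rfl⟩ hβ
      | inr b => exact ⟨b, rfl⟩
    have : e.symm u = ((⟨u, hu⟩ : P), 0) :=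
      Submodule.prodEquivOfIsCompl_symm_apply_left P Q hPQ ⟨u, hu⟩
    simp [this]

variable {σ : Type uσ} [Fintype σ] [DecidableEq σ]
  {V : σ → Type uV} [∀ i, AddCommGroup (V i)] [∀ i, Module k (V i)]
  {W : Type uW} [AddCommGroup W] [Module k W]

/-- **Slot lemma.** Let `M` be multilinear with the "pure tensors of basis vectors"
`f ↦ M (b ∘ f)` linearly independent, and let `w = ∑ c_f M (b ∘ f)`. If for every `e ∈ E` some
linear `Φ` acting as `e` in slot `i₀` on the values of `M` fixes `w`, then every index `f` in the
support of `c` has `i₀`-component in any set `B'` off which the coordinates of the common fixed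
vectors of `E` vanish. [folklore] -/
theorem slot {B : σ → Type*} (M : MultilinearMap k V W) (b : ∀ i, Module.Basis (B i) k (V i))
    (hv : LinearIndependent k (fun f : (∀ i, B i) => M fun i => b i (f i)))
    (i₀ : σ) (E : Set (V i₀ →ₗ[k] V i₀)) (B' : Set (B i₀))
    (hB' : ∀ u : V i₀, (∀ e ∈ E, e u = u) → ∀ β, (b i₀).repr u β ≠ 0 → β ∈ B')
    (c : (∀ i, B i) →₀ k)
    (hfix : ∀ e ∈ E, ∃ Φ : W →ₗ[k] W,
      (∀ m, Φ (M m) = M (Function.update m i₀ (e (m i₀)))) ∧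
        Φ (c.sum fun f a => a • M fun i => b i (f i)) = c.sum fun f a => a • M fun i => b i (f i)) :
    ∀ f ∈ c.support, f i₀ ∈ B' := by
  classical
  set v : (∀ i, B i) → W := fun f => M fun i => b i (f i) with hv_def
  -- splitting the index set into the slot `i₀` and the rest
  let τ : (∀ i, B i) ≃ (∀ j : {j // j ≠ i₀}, B j) × B i₀ :=
    (Equiv.piSplitAt i₀ B).trans (Equiv.prodComm _ _)
  have hτ2 : ∀ f, (τ f).2 = f i₀ := fun f => rfl
  have hτsymm_i₀ : ∀ p, τ.symm p i₀ = p.2 := by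
    intro p
    simp [τ]
  have hτsymm_ne : ∀ p i (h : i ≠ i₀), τ.symm p i = p.1 ⟨i, h⟩ := by
    intro p i h
    simp [τ, h]
  -- the linear maps `x ↦ M (…, x in slot i₀, basis vectors f' elsewhere)`
  let g : (∀ j : {j // j ≠ i₀}, B j) → ∀ i, V i := fun f' i =>
    if h : i = i₀ then 0 else b i (f' ⟨i, h⟩)
  let ℓ : (∀ j : {j // j ≠ i₀}, B j) → V i₀ →ₗ[k] W := fun f' => M.toLinearMap (g f') i₀
  have hℓ : ∀ f' x, ℓ f' x = M (Function.update (g f') i₀ x) := fun _ _ => rfl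
  -- (K1) the pure tensor indexed by the point `β` of the line `f'` is `ℓ f' (b i₀ β)`
  have hK1 : ∀ f' β, v (τ.symm (f', β)) = ℓ f' (b i₀ β) := by
    intro f' β
    simp only [hv_def, hℓ]
    congr 1
    ext i
    by_cases hi : i = i₀
    · subst hi
      rw [Function.update_self, hτsymm_i₀]
    · rw [Function.update_of_ne hi, hτsymm_ne _ _ hi]
      simp [g, hi]
  -- the line sums `u f' = ∑_β c (f', β) • b i₀ β ∈ V i₀`, one for each line `f'` parallel to
  -- the slot `i₀`
  let cc := (c.equivMapDomain τ).curry
  let u : (∀ j : {j // j ≠ i₀}, B j) → V i₀ := fun f' =>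
    Finsupp.linearCombination k (b i₀) (cc f')
  have hu_repr : ∀ f', (b i₀).repr (u f') = cc f' := fun f' =>
    (b i₀).repr_linearCombination _
  have hcc : ∀ f' β, cc f' β = c (τ.symm (f', β)) := by
    intro f' β
    simp [cc, Finsupp.curry_apply, Finsupp.equivMapDomain_apply]
  -- (K2) regrouping the expansion of `w` line by line: `w = ∑_{f'} ℓ f' (u f')`
  have hK2 : (c.sum fun f a => a • v f) = ∑ f' ∈ cc.support, ℓ f' (u f') := by
    calc (c.sum fun f a => a • v f)
        = (c.equivMapDomain τ).sum fun p a => a • v (τ.symm p) := by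
          rw [Finsupp.sum_equivMapDomain]
          simp
      _ = cc.sum fun f' l => l.sum fun β a => a • v (τ.symm (f', β)) :=
          (Finsupp.sum_curry_index _ (fun f' β a => a • v (τ.symm (f', β)))).symm
      _ = ∑ f' ∈ cc.support, ℓ f' (u f') := by
          rw [Finsupp.sum]
          refine Finset.sum_congr rfl fun f' _ => ?_
          simp only [hK1, ← map_smul]
          rw [← map_finsuppSum]
          simp only [u, Finsupp.linearCombination_apply]
  -- (K4) `(y_{f'}) ↦ ∑_{f'} ℓ f' (y f')` is injective: expand each `y f'` in the basis `b i₀` and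
  -- use the linear independence of the pure tensors of basis vectors
  have hK4 : ∀ (R : Finset (∀ j : {j // j ≠ i₀}, B j)) (y : (∀ j : {j // j ≠ i₀}, B j) → V i₀),
      ∑ f' ∈ R, ℓ f' (y f') = 0 → ∀ f' ∈ R, y f' = 0 := by
    intro R y hy f' hf'
    let γ : (∀ i, B i) → k := fun f => (b i₀).repr (y (τ f).1) (τ f).2
    let s : Finset (Σ _ : (∀ j : {j // j ≠ i₀}, B j), B i₀) :=
      R.sigma fun f' => ((b i₀).repr (y f')).support
    let T : Finset (∀ i, B i) := s.image fun p => τ.symm (p.1, p.2)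
    have hinj : Set.InjOn (fun p : (Σ _ : (∀ j : {j // j ≠ i₀}, B j), B i₀) => τ.symm (p.1, p.2))
        ↑s := by
      intro p _ q _ hpq
      have h := τ.symm.injective hpq
      simp only [Prod.mk.injEq] at h
      exact Sigma.ext h.1 (heq_of_eq h.2)
    have hsum : ∑ f ∈ T, γ f • v f = 0 := by
      rw [Finset.sum_image hinj, Finset.sum_sigma]
      simp only [γ, Equiv.apply_symm_apply, hK1, ← map_smul]
      rw [← hy]
      refine Finset.sum_congr rfl fun f' _ => ?_
      rw [← map_sum]
      congr 1
      conv_rhs => rw [← (b i₀).linearCombination_repr (y f')]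
      rw [Finsupp.linearCombination_apply, Finsupp.sum]
    have hγ := linearIndependent_iff'.1 hv T γ hsum
    rw [← (b i₀).repr.map_eq_zero_iff]
    ext β
    by_contra hβ
    have hmem : τ.symm (f', β) ∈ T :=
      Finset.mem_image.2 ⟨⟨f', β⟩, Finset.mem_sigma.2 ⟨hf', Finsupp.mem_support_iff.2 hβ⟩, rfl⟩
    have := hγ _ hmem
    simp only [γ, Equiv.apply_symm_apply] at this
    exact hβ this
  -- (K5) each line sum is fixed by every `e ∈ E`: `Φ` acts as `e` on the line sums (K3), so
  -- `Φ w = w` gives `∑_{f'} ℓ f' (e (u f') - u f') = 0`, and (K4) applies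
  have hK5 : ∀ e ∈ E, ∀ f' ∈ cc.support, e (u f') = u f' := by
    intro e he
    obtain ⟨Φ, hΦ, hΦw⟩ := hfix e he
    have hK3 : ∀ f' x, Φ (ℓ f' x) = ℓ f' (e x) := by
      intro f' x
      rw [hℓ, hℓ, hΦ, Function.update_idem, Function.update_self]
    have h0 : ∑ f' ∈ cc.support, ℓ f' (e (u f') - u f') = 0 := by
      have h1 : Φ (∑ f' ∈ cc.support, ℓ f' (u f')) = ∑ f' ∈ cc.support, ℓ f' (u f') := by
        rw [← hK2]
        exact hΦw
      rw [map_sum] at h1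
      simp only [hK3] at h1
      simp only [map_sub, Finset.sum_sub_distrib, h1, sub_self]
    intro f' hf'
    exact sub_eq_zero.1 (hK4 _ _ h0 f' hf')
  -- (K6) `c f` is the `f i₀`-th coordinate of the line sum through `f`, which lies in the
  -- common fixed space of `E`; so `f i₀ ∈ B'`
  intro f hf
  have hcf : c f ≠ 0 := Finsupp.mem_support_iff.1 hf
  have hccf : cc (τ f).1 (τ f).2 = c f := by
    rw [hcc, Prod.mk.eta, Equiv.symm_apply_apply]
  have hf' : (τ f).1 ∈ cc.support := by
    rw [Finsupp.mem_support_iff]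
    intro h0
    apply hcf
    rw [← hccf, h0]
    rfl
  have huP : ∀ e ∈ E, e (u (τ f).1) = u (τ f).1 := fun e he => hK5 e he _ hf'
  have := hB' (u (τ f).1) huP (τ f).2 (by rw [hu_repr, hccf]; exact hcf)
  simpa [hτ2] using this

/-- **Tensor invariants, slotwise.** Let `M : MultilinearMap k V W` (finitely many slots, `k` a
field) induce an injective map on `⨂ i, V i`, and let `w` lie in its range. Suppose that for
each slot `i` and each `e` in a set `E i` of endomorphisms of `V i`, some linear endomorphism
of `W` acting as `e` in slot `i` on the values of `M` fixes `w`. Then `w` is a linear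
combination of values `M m` with every `m i` in any subspace `P i` containing the common fixed
vectors of `E i`. (For `E i = ρ_i(L_i)` this is `(⨂ V_i)^{∏ L_i} = ⨂ V_i^{L_i}`.) [folklore] -/
theorem mem_span_of_forall_fixed (M : MultilinearMap k V W)
    (hM : Function.Injective (PiTensorProduct.lift M))
    (E : ∀ i, Set (V i →ₗ[k] V i)) (P : ∀ i, Submodule k (V i))
    (hP : ∀ i (x : V i), (∀ e ∈ E i, e x = x) → x ∈ P i)
    (w : W) (hw : w ∈ LinearMap.range (PiTensorProduct.lift M))
    (hfix : ∀ i, ∀ e ∈ E i, ∃ Φ : W →ₗ[k] W,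
      (∀ m, Φ (M m) = M (Function.update m i (e (m i)))) ∧ Φ w = w) :
    w ∈ Submodule.span k (Set.range fun m : (∀ i, P i) => M fun i => (m i : V i)) := by
  classical
  choose B b B' hB'P hPB' using fun i => exists_basis_adapted (k := k) (P i)
  have hv : LinearIndependent k (fun f : (∀ i, B i) => M fun i => b i (f i)) := by
    have := (Basis.piTensorProduct b).linearIndependent.map' (PiTensorProduct.lift M)
      (LinearMap.ker_eq_bot.2 hM)
    have heq : (⇑(PiTensorProduct.lift M) ∘ ⇑(Basis.piTensorProduct b)) =
        fun f : (∀ i, B i) => M fun i => b i (f i) := by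
      ext f
      simp
    rw [← heq]
    exact this
  obtain ⟨c, rfl⟩ : ∃ c : (∀ i, B i) →₀ k, (c.sum fun f a => a • M fun i => b i (f i)) = w := by
    rw [← Finsupp.mem_span_range_iff_exists_finsupp]
    have : LinearMap.range (PiTensorProduct.lift M) =
        Submodule.span k (Set.range fun f : (∀ i, B i) => M fun i => b i (f i)) := by
      rw [LinearMap.range_eq_map, ← (Basis.piTensorProduct b).span_eq, Submodule.map_span,
        ← Set.range_comp]
      congr 1
      ext f
      simp
    rwa [← this]
  have hslot : ∀ i₀, ∀ f ∈ c.support, f i₀ ∈ B' i₀ := fun i₀ =>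
    slot M b hv i₀ (E i₀) (B' i₀)
      (fun x hx β hβ => by_contra fun hβ' => hβ (hPB' i₀ x (hP i₀ x hx) β hβ')) c (hfix i₀)
  rw [Finsupp.sum]
  exact Submodule.sum_mem _ fun f hf => Submodule.smul_mem _ _
    (Submodule.subset_span ⟨fun i => ⟨b i (f i), hB'P i _ (hslot i f hf)⟩, rfl⟩)

end RestrictedTensorProductAux

universe u uk uG v w

/-! ### Neighbourhoods of `1` in the restricted product -/

section Top

variable {ι : Type u} {G : ι → Type uG} [∀ i, Group (G i)] {K : ∀ i, Subgroup (G i)}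

variable [DecidableEq ι]

/-- The structure map sends the family `(1, …, z, …, 1)` to `mulSingle i z`. [folklore] -/
theorem restrictedProduct_structureMap_update_one (i : ι) (z : ↥(K i : Set (G i))) :
    RestrictedProduct.structureMap G (fun i => (K i : Set (G i))) cofinite
      (Function.update (fun i => (⟨1, (K i).one_mem⟩ : ↥(K i : Set (G i)))) i z) =
    RestrictedProduct.mulSingle K i (z : G i) := by
  ext l
  simp only [RestrictedProduct.structureMap_apply, RestrictedProduct.coe_mulSingle_apply]
  by_cases hl : l = i
  · subst hl
    simp
  · simp [Function.update_of_ne hl, Pi.mulSingle_eq_of_ne hl]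

variable [∀ i, TopologicalSpace (G i)]

/-- **Neighbourhoods of `1` in `Πʳ (G_i, K_i)` (all `K_i` open).** A neighbourhood `U` of `1`
contains the whole coordinate subgroup `K_i ↪ Πʳ` for all `i` outside a finite set, and for
every `i` it contains the image of a neighbourhood of `1 ∈ G_i` under the coordinate embedding
`mulSingle i`. (Mathlib: `RestrictedProduct.nhds_eq_map_structureMap` + `nhds_pi`.) [folklore] -/
theorem exists_finset_mulSingle_mem_of_mem_nhds_one (hK : ∀ i, IsOpen (K i : Set (G i)))
    {U : Set (Πʳ i, [G i, K i])} (hU : U ∈ 𝓝 (1 : Πʳ i, [G i, K i])) :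
    ∃ I : Finset ι, (∀ i ∉ I, ∀ g ∈ K i, RestrictedProduct.mulSingle K i g ∈ U) ∧
      ∀ i, ∃ s ∈ 𝓝 (1 : G i), ∀ g ∈ s, RestrictedProduct.mulSingle K i g ∈ U := by
  have h1 : RestrictedProduct.structureMap G (fun i => (K i : Set (G i))) cofinite
      (fun i => ⟨1, (K i).one_mem⟩) = 1 := by
    ext i
    simp
  rw [← h1, RestrictedProduct.nhds_eq_map_structureMap hK, Filter.mem_map, nhds_pi,
    Filter.mem_pi'] at hU
  obtain ⟨I, t, ht, hIt⟩ := hU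
  have key : ∀ i (z : ↥(K i : Set (G i))), (i ∈ I → z ∈ t i) →
      RestrictedProduct.mulSingle K i (z : G i) ∈ U := by
    intro i z hz
    have hmem : Function.update (fun i => (⟨1, (K i).one_mem⟩ : ↥(K i : Set (G i)))) i z ∈
        (↑I : Set ι).pi t := by
      intro l hl
      by_cases hli : l = i
      · subst hli
        simpa using hz hl
      · rw [Function.update_of_ne hli]
        exact mem_of_mem_nhds (ht l)
    have := hIt hmem
    rwa [Set.mem_preimage, restrictedProduct_structureMap_update_one] at this
  refine ⟨I, fun i hi g hg => key i ⟨g, hg⟩ fun h => (hi h).elim, fun i => ?_⟩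
  refine ⟨(↑) '' t i, ?_, ?_⟩
  · rw [← (hK i).isOpenEmbedding_subtypeVal.map_nhds_eq ⟨1, (K i).one_mem⟩]
    exact Filter.image_mem_map (ht i)
  · rintro _ ⟨z, hz, rfl⟩
    exact key i z fun _ => hz

end Top

/-! ### Admissibility -/

section Admissible

variable {ι : Type u} {k : Type uk} [Field k] {G : ι → Type uG} [∀ i, Group (G i)]
  {K : ∀ i, Subgroup (G i)} {V : ι → Type v} [∀ i, AddCommGroup (V i)] [∀ i, Module k (V i)]
  {ρ : ∀ i, Representation k (G i) (V i)} {x₀ : ∀ i, V i} [DecidableEq ι]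
  {W : Type w} [AddCommGroup W] [Module k W] {π : Representation k (Πʳ i, [G i, K i]) W}
  {hx₀ : ∀ᶠ i in cofinite, x₀ i ∈ (ρ i).fixedPoints (K i)}
  {j : RestrictedFamily V x₀ → W} {S₀ : Finset ι}

/-- The coordinate embedding `mulSingle i g` acts on `j (extend S m)` (`i ∈ S`) through the
slot `i` only. [folklore] -/
theorem IsRestrictedTensorProductRep.apply_mulSingle_restrictMultilinear
    (h : IsRestrictedTensorProductRep ρ π hx₀ j S₀) (S : Finset ι) (i : S) (g : G i)
    (m : ∀ i : S, V i) :
    π (RestrictedProduct.mulSingle K (i : ι) g)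
        (h.isRestrictedTensorProduct.isRestrictedMultilinear.restrictMultilinear S m) =
      h.isRestrictedTensorProduct.isRestrictedMultilinear.restrictMultilinear S
        (Function.update m i (ρ i g (m i))) := by
  rw [IsRestrictedMultilinear.restrictMultilinear_apply,
    IsRestrictedMultilinear.restrictMultilinear_apply, ← h.map_smul]
  congr 1
  ext l
  simp only [RestrictedFamily.smul_apply, RestrictedProduct.coe_mulSingle_apply]
  by_cases hl : l = (i : ι)
  · subst hl
    rw [Pi.mulSingle_eq_same, RestrictedFamily.extend_apply_of_mem _ _ i.2,
      RestrictedFamily.extend_apply_of_mem _ _ i.2]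
    simp
  · rw [Pi.mulSingle_eq_of_ne hl, map_one, Module.End.one_apply]
    by_cases hlS : l ∈ S
    · rw [RestrictedFamily.extend_apply_of_mem _ _ hlS,
        RestrictedFamily.extend_apply_of_mem _ _ hlS, Function.update_of_ne]
      exact fun h' => hl (congrArg Subtype.val h')
    · rw [RestrictedFamily.extend_apply_of_notMem _ _ hlS,
        RestrictedFamily.extend_apply_of_notMem _ _ hlS]

variable [∀ i, TopologicalSpace (G i)] [∀ i, IsTopologicalGroup (G i)] in
/-- **A restricted tensor product of admissible representations, almost all spherical, is
admissible** (unfolded form of the named fact `IsRestrictedTensorProductRep.isAdmissible`).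
(Flath 1979, §2, Example 2; Bump 1997, §3.3, pp. 293–294, Proposition 3.4.9 and Theorem 3.4.4.)
[cite: Flath1979, §2 Example 2] -/
theorem IsRestrictedTensorProductRep.isAdmissible_of (hK : ∀ i, IsOpen (K i : Set (G i)))
    (hKc : ∀ i, IsCompact (K i : Set (G i))) (hρ : ∀ i, (ρ i).IsAdmissible)
    (hsph : ∀ᶠ i in cofinite, (ρ i).IsSpherical (K i) ∧ x₀ i ≠ 0)
    (h : IsRestrictedTensorProductRep ρ π hx₀ j S₀) : π.IsAdmissible := by
  haveI : Fact (∀ i, IsOpen (K i : Set (G i))) := ⟨hK⟩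
  refine ⟨IsRestrictedTensorProductRep.isSmooth_holds hK (fun i => (hρ i).isSmooth) h,
    fun K' hK'c => ?_⟩
  classical
  -- (T) the open subgroups `L i ≤ K i` mapped into `K'` by the coordinate embeddings
  obtain ⟨I, hI, hI'⟩ := exists_finset_mulSingle_mem_of_mem_nhds_one (K := K) hK
    (K'.isOpen.mem_nhds (one_mem K'))
  let φ : ∀ i, G i →* Πʳ i, [G i, K i] := fun i =>
    { toFun := RestrictedProduct.mulSingle K i
      map_one' := RestrictedProduct.mulSingle_one K i
      map_mul' := RestrictedProduct.mulSingle_mul K i }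
  let L : ∀ i, Subgroup (G i) := fun i => K i ⊓ (K' : Subgroup (Πʳ i, [G i, K i])).comap (φ i)
  have hL : ∀ i g, g ∈ L i ↔ g ∈ K i ∧ RestrictedProduct.mulSingle K i g ∈ K' := fun i g =>
    Iff.rfl
  have hLopen : ∀ i, IsOpen (L i : Set (G i)) := by
    intro i
    obtain ⟨s, hs, hsU⟩ := hI' i
    apply (L i).isOpen_of_mem_nhds (g := 1)
    filter_upwards [(hK i).mem_nhds (one_mem (K i)), hs] with g hgK hgs
    exact ⟨hgK, hsU g hgs⟩
  have hLc : ∀ i, IsCompact (L i : Set (G i)) := fun i =>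
    (hKc i).of_isClosed_subset ((L i).isClosed_of_isOpen (hLopen i)) fun g hg => hg.1
  have hKL : ∀ i ∉ I, K i ≤ L i := fun i hi g hg => ⟨hg, hI i hi g hg⟩
  let P : ∀ i, Submodule k (V i) := fun i => (ρ i).fixedPoints (L i)
  haveI hPfin : ∀ i, Module.Finite k (P i) := fun i =>
    (hρ i).finite_fixedPoints ⟨L i, hLopen i⟩ (hLc i)
  -- the finite set of bad indices
  have hfin1 : {i | ¬((ρ i).IsSpherical (K i) ∧ x₀ i ≠ 0)}.Finite := eventually_cofinite.1 hsph
  have hfin2 : {i | ¬(x₀ i ∈ (ρ i).fixedPoints (K i))}.Finite := eventually_cofinite.1 hx₀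
  let Sb : Finset ι := S₀ ∪ I ∪ hfin1.toFinset ∪ hfin2.toFinset
  have hS₀Sb : S₀ ⊆ Sb := fun i hi => by simp [Sb, hi]
  have hPle : ∀ i ∉ Sb, ∀ x ∈ P i, ∃ c : k, c • x₀ i = x := by
    intro i hi x hx
    simp only [Sb, Finset.mem_union, Set.Finite.mem_toFinset, Set.mem_setOf_eq, not_or,
      not_not] at hi
    obtain ⟨⟨⟨-, hiI⟩, hsph_i, hx0⟩, hfix_i⟩ := hi
    have hxK : x ∈ (ρ i).fixedPoints (K i) := (ρ i).fixedPoints_antitone (hKL i hiI) hx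
    obtain ⟨c, hc⟩ := (finrank_eq_one_iff_of_nonzero' (⟨x₀ i, hfix_i⟩ : (ρ i).fixedPoints (K i))
      (by simpa using hx0)).1 hsph_i ⟨x, hxK⟩
    exact ⟨c, by simpa using congrArg Subtype.val hc⟩
  -- the finite-dimensional space `F = image of ⨂_{i ∈ Sb} V_i^{L_i}`
  have hj : IsRestrictedMultilinear k j := h.isRestrictedTensorProduct.isRestrictedMultilinear
  let F : Submodule k W := LinearMap.range ((hj.liftFinset Sb).comp
    (PiTensorProduct.map fun i : Sb => (P i).subtype))
  haveI : Module.Finite k F := inferInstance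
  suffices hle : π.fixedPoints (K' : Subgroup (Πʳ i, [G i, K i])) ≤ F from
    Submodule.finiteDimensional_of_le hle
  intro w hw
  rw [Representation.mem_fixedPoints] at hw
  -- Step A: `w` comes from `⨂_{i ∈ S} V i` for a finite `S ⊇ Sb`
  obtain ⟨S, hSbS, hwS⟩ := h.isRestrictedTensorProduct.exists_mem_range_liftFinset Sb w
  -- Step B: the slotwise tensor-invariants lemma
  have hinj : Function.Injective (PiTensorProduct.lift (hj.restrictMultilinear S)) :=
    h.isRestrictedTensorProduct.injective_liftFinset (hS₀Sb.trans hSbS)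
  have hcore := RestrictedTensorProductAux.mem_span_of_forall_fixed (hj.restrictMultilinear S)
    hinj (fun i : S => {e | ∃ g ∈ L i, e = ρ i g}) (fun i : S => P i)
    (fun i x hx => by
      change x ∈ (ρ i).fixedPoints (L i)
      rw [Representation.mem_fixedPoints]
      intro g hg
      exact hx _ ⟨g, hg, rfl⟩)
    w hwS
    (by
      rintro i e ⟨g, hg, rfl⟩
      exact ⟨π (RestrictedProduct.mulSingle K (i : ι) g),
        fun m => h.apply_mulSingle_restrictMultilinear S i g m, hw _ hg.2⟩)
  -- Step C: the spanning vectors lie in `F` (spherical slots outside `Sb` collapse onto `x₀`)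
  refine (Submodule.span_le.2 ?_) hcore
  rintro _ ⟨m, rfl⟩
  have hc : ∀ i : S, ∃ c : k, (i : ι) ∉ Sb → c • x₀ i = m i := fun i => by
    by_cases hi : (i : ι) ∈ Sb
    · exact ⟨1, fun h => (h hi).elim⟩
    · obtain ⟨c, hc⟩ := hPle i hi (m i) (m i).2
      exact ⟨c, fun _ => hc⟩
  choose c hc using hc
  let m' : ∀ i : S, V i := fun i => if (i : ι) ∈ Sb then (m i : V i) else x₀ i
  let c' : ∀ i : S, k := fun i => if (i : ι) ∈ Sb then 1 else c i
  have hmm' : (fun i : S => (m i : V i)) = fun i => c' i • m' i := by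
    funext i
    by_cases hi : (i : ι) ∈ Sb
    · simp [m', c', hi]
    · simp [m', c', hi, hc i hi]
  change hj.restrictMultilinear S (fun i : S => (m i : V i)) ∈ F
  rw [hmm', MultilinearMap.map_smul_univ]
  refine F.smul_mem _ ?_
  let m'' : ∀ i : Sb, P i := fun i => m ⟨i, hSbS i.2⟩
  have hext : RestrictedFamily.extend (x₀ := x₀) S m' =
      RestrictedFamily.extend Sb (fun i => (m'' i : V i)) := by
    ext l
    by_cases hlSb : l ∈ Sb
    · rw [RestrictedFamily.extend_apply_of_mem _ _ (hSbS hlSb),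
        RestrictedFamily.extend_apply_of_mem _ _ hlSb]
      simp [m', m'', hlSb]
    · rw [RestrictedFamily.extend_apply_of_notMem _ _ hlSb]
      by_cases hlS : l ∈ S
      · rw [RestrictedFamily.extend_apply_of_mem _ _ hlS]
        simp [m', hlSb]
      · rw [RestrictedFamily.extend_apply_of_notMem _ _ hlS]
  rw [IsRestrictedMultilinear.restrictMultilinear_apply, hext]
  exact ⟨PiTensorProduct.tprod k m'', by simp⟩

variable [∀ i, TopologicalSpace (G i)] in
/-- **Discharge of the named fact `IsRestrictedTensorProductRep.isAdmissible`** (Flath's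
admissibility of restricted tensor products). (Flath 1979, §2, Example 2; Bump 1997, §3.3,
pp. 293–294, Proposition 3.4.9 and Theorem 3.4.4.) [cite: Flath1979, §2 Example 2] -/
theorem IsRestrictedTensorProductRep.isAdmissible_holds :
    IsRestrictedTensorProductRep.isAdmissible (ρ := ρ) (π := π) (hx₀ := hx₀) (j := j)
      (S₀ := S₀) := by
  intro _ hK hKc hρ hsph h
  exact h.isAdmissible_of hK hKc hρ hsph

end Admissible

end Literature.NumberTheory.Automorphic
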